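import Summits.QuantumFields.BalabanUV.Beta.D1BFx.RProjectorRange
import Summits.QuantumFields.BalabanUV.Beta.D1BFx.GhostStencil

/-!
# `BalabanUV.Beta.D1BFx.RJetAssembly` — road «BF-x» for binder row D1, sub-leaf **J5-asm**: the BOND-LEVEL ASSEMBLY of the
# gauge-term jet `∂_{A_{κ′}(u)} (D_U R_U D_U*)|_{U=1}` from a site-kernel projector complement `R` and its site jet `Ṙ`, with the
# colour-stripping convention of the jet `Ḋ` PINNED against T6's ghost current, and the localisation / transposition / covariance
# sockets T4's `Sbf` asks of its `cR • Rjet` summand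

HONEST DEPENDENCY (page 1, mandatory): continuum YM on T⁴ ⇐ BetaPertH ∧ nine spine estimates (0/9 proved); BetaPertH ⇐ (D1) ∧ (D4) ∧
CAP+tail; G-an2-4 gates asym, D1 and NE2/3/4.  HONEST FRAMING (cell contract, verbatim): «discharging `BetaPertH` makes Bałaban's UV
stability UNCONDITIONAL — a real constructive-QFT result; it is NOT the continuum limit and NOT the Clay problem.»  THIS MODULE
DISCHARGES NOTHING: it types OBJECTS (definitions asserting nothing) and proves [folklore] finite bookkeeping about them (finitely
supported lattice sums in closed form, exponential weights shifted by unit vectors); it instantiates 0 binders of the β-function wall.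
Road BF-x scaffolding for ONE jet family of ONE road to ONE conjunct (D1).  NOT D1, NOT `BetaPertH`, NOT continuum, NOT Clay.
ABSOLUTE RULE (cell charter, verbatim): «No internally-minted statement may enter as a cited fact. Every hypothesis is either
kernel-proved in this package or a verbatim quotation of a PUBLISHED theorem with page reference. The manuscript(s) under audit are NOT
citable for their own disputed steps — they are the thing under adjudication; programme-internal (2001/route/tribunal) claims are never
citable.»  Accordingly there is NO `def … : Prop` below, nothing is cited, and no hypothesis of any theorem is a printed statement.

WHY (skeleton `HOME/beta/skeletons/D1-b2b-balaban-beta-d1-p2.md` node J5 «GAUGE-TERM jets ∂_A(D_A R_A D_A*)|₀»; `HOME/b2b-balaban-beta-d1-p2/TYPER-SPEC-D1BFx.md`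
§1 T4 / §3; `LEAVES-BFx.md` row J5).  Row J5 is being closed in three sub-leaves: J5.0 = the `U = 1` OBJECT `P`, `R = 1 − P` of
[Balaban1985BackgroundPropagators] (3.25) as typed `ℤ^d` kernels (`D1BFx/RProjector`, `RProjectorRange`, leaf-09-g2); J5-model = the matrix
calculus of the jet (`D1BFx/ProjectorJet`, `ProjectorJetDeriv`, leaf-07-g2) and J5-kernel = the SITE jet `Ṙ_{κ′u}` on `ℤ⁴` (leaf-07-g2, in progress);
J5-asm = THIS FILE: given ANY site kernel `R : MKer 4 Unit` and ANY site-jet family `Ṙ : Fin 4 → Site 4 → MKer 4 Unit` (inputs, NOT restated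
here), the BOND kernel `RjetOf R Ṙ κ′ u : MKer 4 (Fin 4)` that T4's first-order fine stencil `Sbf … κ′ u = cE • wilsonA 3 κ′ u + … + cR • Rjet n κ′ u + …`
consumes — the three-term Leibniz expansion of `∂(D_U R_U D_U*)` at `U = 1` along the fine bond variable `A_{κ′}(u)` — together with its sockets.
(Orientation only, nothing asserted: `D_U` is the adjoint covariant gradient on `𝔤`-valued 0-forms, [Balaban1985BackgroundPropagators] (3.2)–(3.3)
pp. 390–391; `D R D*` is the gauge term of (3.26) p. 395.)

THE CONVENTION (the one place a sign can go wrong, leaf-09-g2's closing request journal l.8129 «typeable now once the ∂D stripping convention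
is pinned against T6's `ghCur`»).  All kernels of the road are COLOUR-STRIPPED: a jet `∂_{A^c}` of an operator bilinear in the fields carries one
colour insertion `ad(t_c)`, and the real kernel `K` tabulated is the coefficient of `⟨f(x), ad(t_c) g(z)⟩` — the insertion is READ ON THE COLUMN
FIELD.  The stripped jet of `D_U` is the bond–site matrix `djMat κ′ u (x,α) p = [x = u][α = κ′][p = u + e_κ′]` (§1).  When the insertion lands
on the column field directly the term enters with `+`; when it lands on the row field it is moved across with `ad(t_c)ᵀ = −ad(t_c)` and enters
with `−`.  Hence (§2) the `Ḋ`-terms of the jet of `D ∘ Y ∘ D*` are `(d ∘ Y ∘ Ḋᵀ) − (Ḋ ∘ Y ∘ dᵀ)` (`dJetSw`, proved equal to that difference of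
compositions: `dJetSw_eq_sandwich`) and the site-level jet of `Δ_U = D* D` is `(dᵀ ∘ Ḋ) − (Ḋᵀ ∘ d)` (`dJetSite`, `dJetSite_eq_sandwichT`).  THE PIN:
**`dJetSite_eq_ghCur : dJetSite κ′ u = GhostStencil.ghCur κ′ u`** — the typer's ghost current (T6, p209892) IS the site-level jet in this
convention, so `ghCur`/`Sgh` (hence any `Ṙ` assembled from them and `Pgt`/`Ggh`) and the bond-level `dJetSw`/`RjetOf` below use ONE convention.
Consequence recorded in §3: stripped jets of SYMMETRIC operators are ANTISYMMETRIC kernels (`ghCur_antisymm`'s pattern): `RjetOf_antisymm`.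

CONTENT (all [folklore] / [our object]; everything on the fine lattice `ℤ⁴`, bond `(x, α) = ⟨x, x + e_α⟩`, `e_α = AffineAveraging.unitVec α`):
* §1 `dMat` (the `U = 1` gradient as a bond–site matrix), `djMat κ′ u` (the stripped jet `Ḋ_{κ′u}`), their row actions as finitely supported
  series `tsum_dMat_mul`, `tsum_djMat_mul`.
* §2 `sandwich L Rr Y` (`L ∘ Y ∘ Rrᵀ`, bond kernel), `sandwichT L Rr` (`Lᵀ ∘ Rr`, site kernel); closed forms `dSw Y` (`d ∘ Y ∘ dᵀ`), `dJetSw κ′ u Y`,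
  `dJetSite κ′ u`; the composition identities `sandwich_dMat_dMat`, `dJetSw_eq_sandwich`, `dJetSite_eq_sandwichT`; THE PIN `dJetSite_eq_ghCur`.
* §3 **`RjetOf R Ṙ κ′ u := dJetSw κ′ u R + dSw (Ṙ κ′ u)`**; `RjetOf_antisymm` (for `R` symmetric, `Ṙ κ′ u` antisymmetric); covariance
  `dSw_shiftK`, `dJetSw_translate`, **`RjetOf_translate`** (`shiftK w R = R` and `Ṙ κ′ (u + w) = shiftK (−w) (Ṙ κ′ u)` ⇒
  `RjetOf R Ṙ κ′ (u + w) = shiftK (−w) (RjetOf R Ṙ κ′ u)`; the road uses `w = n • t`).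
* §4 LOCALISATION: `biLoc_dSw` (`BiLoc Y u u C δ ⇒ BiLoc (dSw Y) u u (4Ce^{2δ}) δ`), `biLoc_dJetSw_of_decays` (`Decays R C δ ⇒ BiLoc (dJetSw κ′ u R) u u (4Ce^{2δ}) δ`),
  **`biLoc_RjetOf`** (`⇒ BiLoc (RjetOf R Ṙ κ′ u) u u (4(C + C′)e^{2δ}) δ`), all for `δ ≥ 0`.
The ROAD INSTANCE (`R := 1 − Pgt n a` over J5.0, the block→fine decay conversion for `Pgt`, `Rjet n a Ṙ`) is the sequel `D1BFx/RJetProjector`.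
NOT HERE: the site jet `Ṙ` itself (J5-kernel, leaf-07-g2), colour weights, the value of `cR`, any identification with Bałaban's normalisations,
anything about T4/T5/A-leaves.  Unit `b2b-balaban-beta-d1-formalise-leaf-05` (gen 3), D1 formalisation swarm; `LEAVES-BFx.md` sub-row J5-asm.
-/

namespace Summit.QuantumFields.BalabanUV.Beta.D1BFx.RJetAssembly

open Literature.MathematicalPhysics.QuantumFieldTheory.Balaban1983to89
open Literature.MathematicalPhysics.QuantumFieldTheory.Balaban1983to89.Beta
open B12Sec2to5 (l1 l1_nonneg)
open ExpKernelCalculus (Site MKer BiLoc Decays shiftK)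
open AffineAveraging (unitVec unitVec_apply)
open GhostStencil (ghCur ghCur_apply l1_unitVec unitVec_ne_zero l1_zero)

noncomputable section

/-! ## §1 The two bond–site matrices at `U = 1`: the lattice gradient `d` and the stripped jet `Ḋ_{κ′u}` -/

/-- [our object] THE `U = 1` LATTICE GRADIENT as a bond–site matrix: `dMat x α p = [p = x + e_α] − [p = x]`
(`(d f)(x, α) = f (x + e_α) − f x = Σ_p dMat x α p · f p`).  A definition; asserts nothing. -/
def dMat (x : Site 4) (α : Fin 4) (p : Site 4) : ℝ :=
  (if p = x + unitVec α then (1 : ℝ) else 0) - (if p = x then (1 : ℝ) else 0)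

/-- [our object] THE COLOUR-STRIPPED JET `Ḋ_{κ′u}` of the adjoint covariant gradient `(D_U f)(x, α) = Ad(U_{⟨x,x+e_α⟩}) f(x + e_α) − f x`
along the fine bond variable `A_{κ′}(u)` at `U = 1`, in the `ad(t_c)`-coefficient convention of `Beta.StepJetData` §5 / T6
(`∂_{A^c_{κ′}(u)} D_U f (x, α) = [x = u][α = κ′]·ad(t_c) f(u + e_κ′)`): `djMat κ′ u x α p = [x = u][α = κ′][p = u + e_κ′]`.
A definition; asserts nothing. -/
def djMat (κ' : Fin 4) (u : Site 4) (x : Site 4) (α : Fin 4) (p : Site 4) : ℝ :=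
  if x = u ∧ α = κ' ∧ p = u + unitVec κ' then (1 : ℝ) else 0

variable (κ' : Fin 4) (u : Site 4)

/-- [folklore] `x + e_α ≠ x`. -/
theorem add_unitVec_ne (x : Site 4) (α : Fin 4) : x + unitVec α ≠ x := fun h =>
  unitVec_ne_zero α (by simpa using h)

/-- [folklore] ROW ACTION of `d`: `Σ'_p dMat x α p · f p = f (x + e_α) − f x` (a finitely supported series). -/
theorem tsum_dMat_mul (x : Site 4) (α : Fin 4) (f : Site 4 → ℝ) :
    ∑' p : Site 4, dMat x α p * f p = f (x + unitVec α) - f x := by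
  classical
  have hne := add_unitVec_ne x α
  rw [tsum_eq_sum (s := {x + unitVec α, x}) (fun p hp => by
    simp only [Finset.mem_insert, Finset.mem_singleton, not_or] at hp
    simp only [dMat, if_neg hp.1, if_neg hp.2, sub_self, zero_mul])]
  rw [Finset.sum_pair hne]
  simp only [dMat, if_neg hne, if_neg (Ne.symm hne), ite_true]
  ring

/-- [folklore] ROW ACTION of `Ḋ_{κ′u}`: `Σ'_p djMat κ′ u x α p · f p = [x = u][α = κ′]·f (u + e_κ′)`. -/
theorem tsum_djMat_mul (x : Site 4) (α : Fin 4) (f : Site 4 → ℝ) :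
    ∑' p : Site 4, djMat κ' u x α p * f p = if x = u ∧ α = κ' then f (u + unitVec κ') else 0 := by
  classical
  rw [tsum_eq_single (u + unitVec κ') (fun p hp => by
    simp only [djMat]; rw [if_neg (fun h => hp h.2.2), zero_mul])]
  by_cases h : x = u ∧ α = κ'
  · simp only [djMat, h, and_self, one_mul, if_pos]
  · simp only [djMat, if_neg h]
    rw [if_neg (fun h' => h ⟨h'.1, h'.2.1⟩), zero_mul]

/-! ## §2 Sandwiches of a site kernel and THE CONVENTION: `+` when `Ḋ` carries the column leg, `−` when it carries the row leg -/

/-- [our object] The bond kernel `L ∘ Y ∘ Rrᵀ` of two bond–site matrices around a site kernel: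
`sandwich L Y Rr (x,α) (z,β) = Σ'_p Σ'_q L x α p · Y p q · Rr z β q`. -/
def sandwich (L Rr : Site 4 → Fin 4 → Site 4 → ℝ) (Y : MKer 4 Unit) : MKer 4 (Fin 4) := fun x z α β =>
  ∑' p : Site 4, L x α p * ∑' q : Site 4, Y p q () () * Rr z β q

/-- [our object] The site kernel `Lᵀ ∘ Rr` of two bond–site matrices (identity on bonds in the middle):
`sandwichT L Rr x z = Σ'_w Σ_α L w α x · Rr w α z`. -/
def sandwichT (L Rr : Site 4 → Fin 4 → Site 4 → ℝ) : MKer 4 Unit := fun x z _ _ =>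
  ∑' w : Site 4, ∑ α : Fin 4, L w α x * Rr w α z

/-- [our object] `d ∘ Y ∘ dᵀ` in CLOSED FORM: `Y(x+e_α, z+e_β) − Y(x+e_α, z) − Y(x, z+e_β) + Y(x, z)`. -/
def dSw (Y : MKer 4 Unit) : MKer 4 (Fin 4) := fun x z α β =>
  Y (x + unitVec α) (z + unitVec β) () () - Y (x + unitVec α) z () () - Y x (z + unitVec β) () () + Y x z () ()

/-- [our object] THE TWO `Ḋ`-TERMS OF THE JET OF `D_U ∘ Y ∘ D_U*` at the fine bond `⟨u, u+e_κ′⟩` in CLOSED FORM, with THE CONVENTION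
(the colour insertion `ad(t_c)` is read on the COLUMN field; moving it off the row field costs the sign of `ad(t_c)ᵀ = −ad(t_c)`):
`(d ∘ Y ∘ Ḋᵀ) − (Ḋ ∘ Y ∘ dᵀ)`, i.e.
`[z = u][β = κ′]·(Y(x+e_α, u+e_κ′) − Y(x, u+e_κ′)) − [x = u][α = κ′]·(Y(u+e_κ′, z+e_β) − Y(u+e_κ′, z))`. -/
def dJetSw (Y : MKer 4 Unit) : MKer 4 (Fin 4) := fun x z α β =>
  (if z = u ∧ β = κ' then Y (x + unitVec α) (u + unitVec κ') () () - Y x (u + unitVec κ') () () else 0)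
    - (if x = u ∧ α = κ' then Y (u + unitVec κ') (z + unitVec β) () () - Y (u + unitVec κ') z () () else 0)

/-- [our object] THE SITE-LEVEL TWIN (jet of `D_U* D_U = Δ_U` at `U = 1`, SAME convention): `(dᵀ ∘ Ḋ) − (Ḋᵀ ∘ d)` in closed form,
`([x = u+e_κ′] − [x = u])·[z = u+e_κ′] − [x = u+e_κ′]·([z = u+e_κ′] − [z = u])`. -/
def dJetSite : MKer 4 Unit := fun x z _ _ =>
  ((if x = u + unitVec κ' then (1 : ℝ) else 0) - (if x = u then 1 else 0)) * (if z = u + unitVec κ' then (1 : ℝ) else 0)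
    - (if x = u + unitVec κ' then (1 : ℝ) else 0) * ((if z = u + unitVec κ' then (1 : ℝ) else 0) - (if z = u then 1 else 0))

variable (Y : MKer 4 Unit)

/-- [our object] Unfolding `dSw`. -/
theorem dSw_apply (x z : Site 4) (α β : Fin 4) : dSw Y x z α β =
    Y (x + unitVec α) (z + unitVec β) () () - Y (x + unitVec α) z () () - Y x (z + unitVec β) () () + Y x z () () := rfl

/-- [our object] Unfolding `dJetSw`. -/
theorem dJetSw_apply (x z : Site 4) (α β : Fin 4) : dJetSw κ' u Y x z α β =
    (if z = u ∧ β = κ' then Y (x + unitVec α) (u + unitVec κ') () () - Y x (u + unitVec κ') () () else 0)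
      - (if x = u ∧ α = κ' then Y (u + unitVec κ') (z + unitVec β) () () - Y (u + unitVec κ') z () () else 0) := rfl

/-- [folklore] `d ∘ Y ∘ dᵀ` IS the composition: `sandwich dMat Y dMat = dSw Y`. -/
theorem sandwich_dMat_dMat : sandwich dMat dMat Y = dSw Y := by
  funext x z α β
  simp only [sandwich, dSw]
  have inner : ∀ p : Site 4, ∑' q : Site 4, Y p q () () * dMat z β q = Y p (z + unitVec β) () () - Y p z () () := fun p => by
    simp_rw [mul_comm (Y p _ () ()) (dMat z β _)]
    exact tsum_dMat_mul z β (fun q => Y p q () ())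
  simp_rw [inner]
  rw [tsum_dMat_mul x α (fun p => Y p (z + unitVec β) () () - Y p z () ())]
  ring

/-- [folklore] THE CONVENTION AS A THEOREM (bond level): `dJetSw κ′ u Y = sandwich dMat Y (djMat κ′ u) − sandwich (djMat κ′ u) Y dMat`
— `+ (d ∘ Y ∘ Ḋᵀ)` (jet on the column leg) `− (Ḋ ∘ Y ∘ dᵀ)` (jet on the row leg). -/
theorem dJetSw_eq_sandwich : dJetSw κ' u Y = sandwich dMat (djMat κ' u) Y - sandwich (djMat κ' u) dMat Y := by
  funext x z α β
  show dJetSw κ' u Y x z α β = sandwich dMat (djMat κ' u) Y x z α β - sandwich (djMat κ' u) dMat Y x z α β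
  simp only [sandwich, dJetSw]
  have innerJ : ∀ p : Site 4, ∑' q : Site 4, Y p q () () * djMat κ' u z β q =
      if z = u ∧ β = κ' then Y p (u + unitVec κ') () () else 0 := fun p => by
    simp_rw [mul_comm (Y p _ () ()) (djMat κ' u z β _)]
    exact tsum_djMat_mul κ' u z β (fun q => Y p q () ())
  have innerD : ∀ p : Site 4, ∑' q : Site 4, Y p q () () * dMat z β q = Y p (z + unitVec β) () () - Y p z () () := fun p => by
    simp_rw [mul_comm (Y p _ () ()) (dMat z β _)]
    exact tsum_dMat_mul z β (fun q => Y p q () ())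
  simp_rw [innerJ, innerD]
  rw [tsum_dMat_mul x α, tsum_djMat_mul κ' u x α]
  by_cases hz : z = u ∧ β = κ'
  · simp only [if_pos hz]
  · simp only [if_neg hz, sub_self, zero_sub]

/-- [folklore] THE CONVENTION AS A THEOREM (site level): `dJetSite κ′ u = sandwichT dMat (djMat κ′ u) − sandwichT (djMat κ′ u) dMat`. -/
theorem dJetSite_eq_sandwichT : dJetSite κ' u = sandwichT dMat (djMat κ' u) - sandwichT (djMat κ' u) dMat := by
  classical
  funext x z a b
  show dJetSite κ' u x z a b = sandwichT dMat (djMat κ' u) x z a b - sandwichT (djMat κ' u) dMat x z a b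
  simp only [sandwichT, dJetSite]
  -- both series are supported at the single bond base `w = u`
  have h1 : ∑' w : Site 4, ∑ α : Fin 4, dMat w α x * djMat κ' u w α z =
      ((if x = u + unitVec κ' then (1 : ℝ) else 0) - (if x = u then 1 else 0)) * (if z = u + unitVec κ' then (1 : ℝ) else 0) := by
    rw [tsum_eq_single u (fun w hw => Finset.sum_eq_zero fun α _ => by
      simp only [djMat]; rw [if_neg (fun h => hw h.1), mul_zero])]
    rw [Finset.sum_eq_single κ' (fun α _ hα => by simp only [djMat]; rw [if_neg (fun h => hα h.2.1), mul_zero])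
      (fun h => absurd (Finset.mem_univ _) h)]
    simp only [dMat, djMat, true_and]
  have h2 : ∑' w : Site 4, ∑ α : Fin 4, djMat κ' u w α x * dMat w α z =
      (if x = u + unitVec κ' then (1 : ℝ) else 0) * ((if z = u + unitVec κ' then (1 : ℝ) else 0) - (if z = u then 1 else 0)) := by
    rw [tsum_eq_single u (fun w hw => Finset.sum_eq_zero fun α _ => by
      simp only [djMat]; rw [if_neg (fun h => hw h.1), zero_mul])]
    rw [Finset.sum_eq_single κ' (fun α _ hα => by simp only [djMat]; rw [if_neg (fun h => hα h.2.1), zero_mul])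
      (fun h => absurd (Finset.mem_univ _) h)]
    simp only [dMat, djMat, true_and]
  rw [h1, h2]

/-- [folklore] **THE CONVENTION PIN AGAINST T6**: the site-level jet assembled with THIS file's `Ḋ` and sign rule IS the typer's ghost
current: `dJetSite κ′ u = GhostStencil.ghCur κ′ u` — so `GhostStencil.ghCur` (hence `Sgh`, and any site jet `Ṙ` built from it) and the
bond-level `dJetSw` below use ONE colour-stripping convention. -/
theorem dJetSite_eq_ghCur : dJetSite κ' u = ghCur κ' u := by
  funext x z a b
  simp only [dJetSite, ghCur_apply]
  have hne := add_unitVec_ne u κ'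
  by_cases hx1 : x = u + unitVec κ' <;> by_cases hx2 : x = u <;> by_cases hz1 : z = u + unitVec κ' <;> by_cases hz2 : z = u
  all_goals (first | (exfalso; exact hne (hx1 ▸ hx2 ▸ rfl)) | skip)
  all_goals simp only [hx1, hx2, hz1, hz2, if_true, if_false, and_true, and_self, hne, Ne.symm hne]
  all_goals norm_num

/-! ## §3 The assembled jet, its transposition law and its translation covariance -/

/-- [our object] **THE BOND-LEVEL GAUGE-TERM JET** assembled from a site-kernel projector complement `R` and a site jet `Ṙ` at the fine
bond `⟨u, u + e_κ′⟩`: `RjetOf R Ṙ κ′ u := dJetSw κ′ u R + dSw (Ṙ κ′ u)` — the three-term Leibniz expansion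
`∂(D_U R_U D_U*) = (d∘R∘Ḋᵀ − Ḋ∘R∘dᵀ) + d∘Ṙ∘dᵀ` in the convention of §2.  Which `R`, `Ṙ` are Bałaban's is NOT decided here
(`R` = J5.0's `1 − Pgt n a`, `Ṙ` = the J5-kernel object); a definition asserting nothing. -/
def RjetOf (R : MKer 4 Unit) (Rd : Fin 4 → Site 4 → MKer 4 Unit) (κ' : Fin 4) (u : Site 4) : MKer 4 (Fin 4) :=
  dJetSw κ' u R + dSw (Rd κ' u)

/-- [our object] Unfolding `RjetOf`. -/
theorem RjetOf_apply (R : MKer 4 Unit) (Rd : Fin 4 → Site 4 → MKer 4 Unit) (x z : Site 4) (α β : Fin 4) :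
    RjetOf R Rd κ' u x z α β = dJetSw κ' u R x z α β + dSw (Rd κ' u) x z α β := rfl

/-- [folklore] `d ∘ Y ∘ dᵀ` of an ANTISYMMETRIC site kernel is antisymmetric under the exchange of the two bonds. -/
theorem dSw_transpose_of_antisymm (hY : ∀ x z : Site 4, Y z x () () = -Y x z () ()) (x z : Site 4) (α β : Fin 4) :
    dSw Y z x β α = -dSw Y x z α β := by
  simp only [dSw_apply, hY (x + unitVec α) (z + unitVec β), hY x (z + unitVec β), hY (x + unitVec α) z, hY x z]
  ring

/-- [folklore] The `Ḋ`-terms of a SYMMETRIC site kernel are antisymmetric under the exchange of the two bonds (the convention's sign). -/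
theorem dJetSw_transpose_of_symm (hY : ∀ x z : Site 4, Y z x () () = Y x z () ()) (x z : Site 4) (α β : Fin 4) :
    dJetSw κ' u Y z x β α = -dJetSw κ' u Y x z α β := by
  simp only [dJetSw_apply, hY (u + unitVec κ') (x + unitVec α), hY (u + unitVec κ') x]
  rw [hY (z + unitVec β) (u + unitVec κ'), hY z (u + unitVec κ')]
  ring

/-- [folklore] **TRANSPOSITION LAW OF THE ASSEMBLED JET**: for `R` symmetric and every `Ṙ κ′ u` antisymmetric (the stripped jet of a
symmetric operator is antisymmetric in this convention, like `GhostStencil.ghCur_antisymm`), `RjetOf R Ṙ κ′ u` is antisymmetric. -/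
theorem RjetOf_antisymm {R : MKer 4 Unit} {Rd : Fin 4 → Site 4 → MKer 4 Unit} (hR : ∀ x z : Site 4, R z x () () = R x z () ())
    (hRd : ∀ κ' u x z, Rd κ' u z x () () = -Rd κ' u x z () ()) (x z : Site 4) (α β : Fin 4) :
    RjetOf R Rd κ' u z x β α = -RjetOf R Rd κ' u x z α β := by
  rw [RjetOf_apply, RjetOf_apply, dJetSw_transpose_of_symm κ' u R hR, dSw_transpose_of_antisymm (Rd κ' u) (hRd κ' u)]
  ring

/-- [folklore] `dSw` commutes with simultaneous shifts. -/
theorem dSw_shiftK (v : Site 4) : dSw (shiftK v Y) = shiftK v (dSw Y) := by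
  funext x z α β
  simp only [dSw_apply, shiftK, add_right_comm _ v]

/-- [folklore] FINE-TRANSLATION COVARIANCE of the `Ḋ`-terms: `dJetSw κ′ (u + v) Y = shiftK (−v) (dJetSw κ′ u (shiftK v Y))`. -/
theorem dJetSw_translate (v : Site 4) : dJetSw κ' (u + v) Y = shiftK (-v) (dJetSw κ' u (shiftK v Y)) := by
  funext x z α β
  simp only [dJetSw_apply, shiftK]
  have e1 : ∀ w : Site 4, w + -v = u ↔ w = u + v := fun w => by
    constructor <;> intro h
    · rw [← h]; abel
    · rw [h]; abel
  have e2 : u + unitVec κ' + v = u + v + unitVec κ' := add_right_comm _ _ _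
  have e3 : x + -v + unitVec α + v = x + unitVec α := by abel
  have e4 : z + -v + unitVec β + v = z + unitVec β := by abel
  have e5 : x + -v + v = x := by abel
  have e6 : z + -v + v = z := by abel
  simp only [e1, e2, e3, e4, e5, e6]

/-- [folklore] **BLOCK-TRANSLATION COVARIANCE OF THE ASSEMBLED JET**: if `R` is invariant under the simultaneous shift by `w` and the site
jet is covariant (`Ṙ κ′ (u + w) = shiftK (−w) (Ṙ κ′ u)`), then `RjetOf R Ṙ κ′ (u + w) = shiftK (−w) (RjetOf R Ṙ κ′ u)` — the (St♭) shape of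
`StepJetData.wilsonA_translate` / `GhostStencil.Sgh_translate` (there `w = n • t`). -/
theorem RjetOf_translate {R : MKer 4 Unit} {Rd : Fin 4 → Site 4 → MKer 4 Unit} (w : Site 4) (hR : shiftK w R = R)
    (hRd : ∀ κ' u, Rd κ' (u + w) = shiftK (-w) (Rd κ' u)) :
    RjetOf R Rd κ' (u + w) = shiftK (-w) (RjetOf R Rd κ' u) := by
  funext x z α β
  have h1 : dJetSw κ' (u + w) R = shiftK (-w) (dJetSw κ' u R) := by rw [dJetSw_translate, hR]
  have h2 : dSw (Rd κ' (u + w)) = shiftK (-w) (dSw (Rd κ' u)) := by rw [hRd, dSw_shiftK]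
  simp only [RjetOf_apply, h1, h2, shiftK]

/-! ## §4 Localisation sockets -/

/-- [folklore] `ℓ¹`-comparison ⇒ weight comparison: `l1 a ≤ l1 b + k` gives `e^{−δ|b|₁} ≤ e^{δk}·e^{−δ|a|₁}` for `δ ≥ 0`. -/
theorem exp_le_of_l1_le {δ k : ℝ} (hδ : 0 ≤ δ) {a b : Site 4} (h : l1 a ≤ l1 b + k) :
    Real.exp (-δ * l1 b) ≤ Real.exp (δ * k) * Real.exp (-δ * l1 a) := by
  rw [← Real.exp_add]
  exact Real.exp_le_exp.2 (by nlinarith)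

/-- [folklore] `|x − u|₁ ≤ |x + e_α − u|₁ + 1`. -/
theorem l1_sub_le_shift_left (x : Site 4) (α : Fin 4) : l1 (x - u) ≤ l1 (x + unitVec α - u) + 1 := by
  have h := ExpKernelCalculus.l1_sub_triangle x (x + unitVec α) u
  have e : l1 (x - (x + unitVec α)) = 1 := by rw [ExpKernelCalculus.l1_sub_symm, add_sub_cancel_left, l1_unitVec]
  linarith

/-- [folklore] `|x − u|₁ ≤ |x − (u + e_κ)|₁ + 1`. -/
theorem l1_sub_le_shift_right (x : Site 4) : l1 (x - u) ≤ l1 (x - (u + unitVec κ')) + 1 := by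
  have h := ExpKernelCalculus.l1_sub_triangle x (u + unitVec κ') u
  rwa [add_sub_cancel_left, l1_unitVec] at h

/-- [folklore] `|x − u|₁ ≤ |x + e_α − (u + e_κ)|₁ + 2`. -/
theorem l1_sub_le_shift_both (x : Site 4) (α : Fin 4) : l1 (x - u) ≤ l1 (x + unitVec α - (u + unitVec κ')) + 2 := by
  have h1 := l1_sub_le_shift_left u x α
  have h2 := l1_sub_le_shift_right κ' u (x + unitVec α)
  linarith

/-- [folklore] **LOCALISATION OF `d ∘ Y ∘ dᵀ`**: `BiLoc Y u u C δ ⇒ BiLoc (dSw Y) u u (4·C·e^{2δ}) δ` (`δ ≥ 0`). -/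
theorem biLoc_dSw {C δ : ℝ} (hδ : 0 ≤ δ) (hY : BiLoc Y u u C δ) : BiLoc (dSw Y) u u (4 * C * Real.exp (2 * δ)) δ := by
  intro x z α β
  have hC : 0 ≤ C := hY.nonneg ()
  have hex : 1 ≤ Real.exp δ := Real.one_le_exp hδ
  have wx := exp_le_of_l1_le hδ (l1_sub_le_shift_left u x α)
  have wz := exp_le_of_l1_le hδ (l1_sub_le_shift_left u z β)
  rw [mul_one] at wx wz
  have wx0 : Real.exp (-δ * l1 (x - u)) ≤ Real.exp δ * Real.exp (-δ * l1 (x - u)) :=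
    le_mul_of_one_le_left (Real.exp_pos _).le hex
  have wz0 : Real.exp (-δ * l1 (z - u)) ≤ Real.exp δ * Real.exp (-δ * l1 (z - u)) :=
    le_mul_of_one_le_left (Real.exp_pos _).le hex
  have key : ∀ p q : Site 4, Real.exp (-δ * l1 (p - u)) ≤ Real.exp δ * Real.exp (-δ * l1 (x - u)) →
      Real.exp (-δ * l1 (q - u)) ≤ Real.exp δ * Real.exp (-δ * l1 (z - u)) →
      |Y p q () ()| ≤ C * Real.exp (2 * δ) * (Real.exp (-δ * l1 (x - u)) * Real.exp (-δ * l1 (z - u))) := by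
    intro p q hp hq
    refine (hY p q () ()).trans ?_
    rw [mul_add, Real.exp_add]
    calc C * (Real.exp (-δ * l1 (p - u)) * Real.exp (-δ * l1 (q - u)))
        ≤ C * ((Real.exp δ * Real.exp (-δ * l1 (x - u))) * (Real.exp δ * Real.exp (-δ * l1 (z - u)))) :=
          mul_le_mul_of_nonneg_left (mul_le_mul hp hq (Real.exp_pos _).le (by positivity)) hC
      _ = C * Real.exp (2 * δ) * (Real.exp (-δ * l1 (x - u)) * Real.exp (-δ * l1 (z - u))) := by
          rw [two_mul, Real.exp_add]; ring
  have t1 := key _ _ wx wz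
  have t2 := key _ _ wx wz0
  have t3 := key _ _ wx0 wz
  have t4 := key _ _ wx0 wz0
  rw [dSw_apply, mul_add (-δ), Real.exp_add]
  have i1 := abs_add_le (Y (x + unitVec α) (z + unitVec β) () () - Y (x + unitVec α) z () () - Y x (z + unitVec β) () ())
    (Y x z () ())
  have i2 := abs_sub (Y (x + unitVec α) (z + unitVec β) () () - Y (x + unitVec α) z () ()) (Y x (z + unitVec β) () ())
  have i3 := abs_sub (Y (x + unitVec α) (z + unitVec β) () ()) (Y (x + unitVec α) z () ())
  linarith

/-- [folklore] A function decaying away from `u + e_κ′` has `|g (x + e_α) − g x| ≤ 2·C·e^{2δ}·e^{−δ|x−u|₁}` (`δ ≥ 0`). -/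
theorem abs_sub_le_of_decay {g : Site 4 → ℝ} {C δ : ℝ} (hδ : 0 ≤ δ) (hC : 0 ≤ C)
    (hg : ∀ p, |g p| ≤ C * Real.exp (-δ * l1 (p - (u + unitVec κ')))) (x : Site 4) (α : Fin 4) :
    |g (x + unitVec α) - g x| ≤ 2 * C * Real.exp (2 * δ) * Real.exp (-δ * l1 (x - u)) := by
  have w1 := exp_le_of_l1_le hδ (l1_sub_le_shift_both κ' u x α)
  have w2 := exp_le_of_l1_le hδ (l1_sub_le_shift_right κ' u x)
  rw [mul_comm δ 2] at w1
  rw [mul_one] at w2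
  have hexδ : Real.exp δ ≤ Real.exp (2 * δ) := Real.exp_le_exp.2 (by linarith)
  have hE := (Real.exp_pos (-δ * l1 (x - u))).le
  have b1 := (hg (x + unitVec α)).trans (mul_le_mul_of_nonneg_left w1 hC)
  have b2 := (hg x).trans (mul_le_mul_of_nonneg_left (w2.trans (mul_le_mul_of_nonneg_right hexδ hE)) hC)
  have i := abs_sub (g (x + unitVec α)) (g x)
  linarith

/-- [folklore] **LOCALISATION OF THE `Ḋ`-TERMS**: a site kernel with off-diagonal `ℓ¹`-decay (`Decays R C δ`, `δ ≥ 0`) gives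
`BiLoc (dJetSw κ′ u R) u u (4·C·e^{2δ}) δ` — each term is pinned at the bond `⟨u, u+e_κ′⟩` on one leg and decays away from it on the other. -/
theorem biLoc_dJetSw_of_decays {R : MKer 4 Unit} {C δ : ℝ} (hδ : 0 ≤ δ) (hR : Decays R C δ) :
    BiLoc (dJetSw κ' u R) u u (4 * C * Real.exp (2 * δ)) δ := by
  intro x z α β
  have hC : 0 ≤ C := le_trans (abs_nonneg _) ((hR u u () ()).trans (by rw [sub_self]; simp [l1]))
  have hM : 0 ≤ 2 * C * Real.exp (2 * δ) := by positivity
  rw [dJetSw_apply, mul_add (-δ), Real.exp_add]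
  -- column-pinned term: `z = u`, decay in `x`
  have T1 : |(if z = u ∧ β = κ' then R (x + unitVec α) (u + unitVec κ') () () - R x (u + unitVec κ') () () else 0)|
      ≤ 2 * C * Real.exp (2 * δ) * (Real.exp (-δ * l1 (x - u)) * Real.exp (-δ * l1 (z - u))) := by
    by_cases hz : z = u ∧ β = κ'
    · rw [if_pos hz, hz.1, sub_self, show l1 (0 : Site 4) = 0 by simp [l1], mul_zero, Real.exp_zero, mul_one]
      exact abs_sub_le_of_decay κ' u hδ hC (fun p => hR p (u + unitVec κ') () ()) x α
    · rw [if_neg hz, abs_zero]; positivity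
  -- row-pinned term: `x = u`, decay in `z`
  have T2 : |(if x = u ∧ α = κ' then R (u + unitVec κ') (z + unitVec β) () () - R (u + unitVec κ') z () () else 0)|
      ≤ 2 * C * Real.exp (2 * δ) * (Real.exp (-δ * l1 (x - u)) * Real.exp (-δ * l1 (z - u))) := by
    by_cases hx : x = u ∧ α = κ'
    · rw [if_pos hx, hx.1, sub_self, show l1 (0 : Site 4) = 0 by simp [l1], mul_zero, Real.exp_zero, one_mul]
      exact abs_sub_le_of_decay κ' u hδ hC (fun q => by rw [ExpKernelCalculus.l1_sub_symm]; exact hR (u + unitVec κ') q () ()) z β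
    · rw [if_neg hx, abs_zero]; positivity
  have i := abs_sub (if z = u ∧ β = κ' then R (x + unitVec α) (u + unitVec κ') () () - R x (u + unitVec κ') () () else 0)
    (if x = u ∧ α = κ' then R (u + unitVec κ') (z + unitVec β) () () - R (u + unitVec κ') z () () else 0)
  linarith

/-- [folklore] **LOCALISATION SOCKET OF THE ASSEMBLED JET**: `Decays R C δ` and `BiLoc (Ṙ κ′ u) u u C′ δ` (`δ ≥ 0`) give
`BiLoc (RjetOf R Ṙ κ′ u) u u (4·(C + C′)·e^{2δ}) δ` — the `locStencil` shape T4's `Sbf` asks of its `cR • Rjet` summand. -/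
theorem biLoc_RjetOf {R : MKer 4 Unit} {Rd : Fin 4 → Site 4 → MKer 4 Unit} {C C' δ : ℝ} (hδ : 0 ≤ δ) (hR : Decays R C δ)
    (hRd : BiLoc (Rd κ' u) u u C' δ) : BiLoc (RjetOf R Rd κ' u) u u (4 * (C + C') * Real.exp (2 * δ)) δ := by
  intro x z α β
  have h1 := biLoc_dJetSw_of_decays κ' u hδ hR x z α β
  have h2 := biLoc_dSw u (Rd κ' u) hδ hRd x z α β
  have i := abs_add_le (dJetSw κ' u R x z α β) (dSw (Rd κ' u) x z α β)
  rw [RjetOf_apply]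
  linarith

end

end Summit.QuantumFields.BalabanUV.Beta.D1BFx.RJetAssembly
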